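import Summits.BirchSwinnertonDyer.BirchSwinnertonDyer.Theorems.PrintCf2SplitBadTwoHalvesOfHeegnerIndexSmallConductor
import Summits.BirchSwinnertonDyer.BirchSwinnertonDyer.Theorems.PrintCf2SplitBadTwoHalvesOverTwistField
import Summits.BirchSwinnertonDyer.BirchSwinnertonDyer.Theorems.PrintCf2SplitBadTwoHalvesOverCMField
import Summits.BirchSwinnertonDyer.BirchSwinnertonDyer.Theorems.GoldfeldAllTwistsTwoConverseTwinAdditiveShaAn
import Summits.BirchSwinnertonDyer.BirchSwinnertonDyer.Theorems.PrintCf2SplitBadTwoTamagawaSevenDvd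
import Summits.BirchSwinnertonDyer.BirchSwinnertonDyer.Theorems.PrintCf2SplitBadTwoTorsionSevenDvd
import Summits.BirchSwinnertonDyer.BirchSwinnertonDyer.Theorems.PrintCf2SplitBadTwoDyadicTorsionStubEll
import Summits.BirchSwinnertonDyer.Rank1Residual.X11b.TamagawaHeegnerExact
import HarnessLib

/-!
# STUB-IDEAS k1 (gen 25) for `stub_heegnerIndexLowerAtTwo` — typed sketch (seat `sidea-stub_heegnerIndexLowerAtTwo-1-g25`)

Crux `PrintCf2.SplitBadTwoLowerHalfOfFacts` (stmt-BirchSwinnertonDyer-27851), stub of record `stub_heegnerIndexLowerAtTwo`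
(skeleton `SplitBadTwoLowerHalfOfFacts_index.lean`, ns `…Cruxes.SplitBadTwoLowerHalfOfFacts.HeegnerIndexTwo`). Technique «weaken /
strengthen»: the WEAKEST SUFFICIENT ℚ-side input for the registered stub text is not `MissingLowerBoundAt W 2` (defect `0`, T0) but
DEFECT ONE `ord₂ #Ш_an(W) ≤ ord₂ #Ш(W)[2^∞] + 1`, once Cassels–Tate over the Heegner field is displayed (price R1 of the STUB-PLAN):
§1 proves it on the registered v3 frame (`heegnerIndexLower_two_of_defectOne_of_twist`, `stubLowerText_of_forall_defectOne`) and the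
ℚ-side upgrade `defect ≤ 1 ⟹ defect ≤ 0` (`missingLowerBoundAt_of_defectOne_of_frame`); §2 is the ℤ-shadow of the v4.9 chain with the
parity unit (INT threshold `−3`, sharp at `−4`) and the per-key anchor calculus of B26 (d′); §3 certifies that ORDER-NOW item R179
(«an anchor with full digit `x ≤ 1` on an open key») is VACUOUS — `ord₂ Tam(W) ≥ 4` for every model of `X₀(49)^{(d)}` with a prime
`ℓ ∤ 14` dividing `d`, all `d` (also `7 ∣ d`), hence local digit `≥ 2` (`≥ 4` on key `(1,3)`); §4 the norm ↔ exponent glue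
(integrality / GHOST / (T) ↦ `eA ≥ μ − 2x₀`) and the law-free B28♯ sandwich; §5 decidable digits for the «three towers» remark.
THEOREMS ONLY — no `sorry`, no `def`, no instance, no named fact. BSD is NOT proved for any curve by any of this.
-/

set_option autoImplicit false
set_option linter.dupNamespace false

noncomputable section

open scoped Classical NumberField

namespace Summit.BirchSwinnertonDyer.BirchSwinnertonDyer.Cruxes.SplitBadTwoLowerHalfOfFacts.StubIdeasK1G25

open WeierstrassCurve NumberField IsDedekindDomain
  Literature.NumberTheory.EllipticCurves Literature.NumberTheory.EllipticCurves.ModularForms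
  Literature.NumberTheory.EllipticCurves.Rank1Residual Literature.NumberTheory.EllipticCurves.Rank1Residual.Typed
  Literature.NumberTheory.EllipticCurves.KrizLi2019
  Summit.BirchSwinnertonDyer.Rank1Residual Summit.BirchSwinnertonDyer.Rank1Residual.AdditivePotMult
  Summit.BirchSwinnertonDyer.BirchSwinnertonDyer.Theses.UniversalToricDescent
  Summit.BirchSwinnertonDyer.BirchSwinnertonDyer.Theorems
  Summit.BirchSwinnertonDyer.BirchSwinnertonDyer.Theorems.PrintCf2.EisensteinTwo
  Summit.BirchSwinnertonDyer.BirchSwinnertonDyer.Theorems.PrintCf2.KsideFiniteTwo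

/-! ### §1 DEFECT ONE over `ℚ` + Cassels–Tate over `K` ⟹ the registered index LOWER bound (typed, v3 currency) -/

/-- **Frame core.** On a Heegner frame of `W` (`r_an = 1`, `d_K < −4`, `P` the Heegner trace, non-torsion), GIVEN GZ/Kolyvagin/GZK/
modularity (`hF`), Milne (★) (`hMilne`), the twin's `BSD₂` (`hTw`) and Cassels–Tate over `K` (`hCT`): `#Ш_an(W) = q ∈ ℚ` with
`ord₂ q − ord₂ #Ш(W) = 2·ord₂ I − 2·ord₂ c − 2t − 2s`, where `ord₂ c_K = 2t` (JSW (7.3.1): `c_K = (∏ c_ℓ)²` at a Heegner field)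
and `ord₂ #Ш(E/K)[2^∞] = 2s` (Cassels–Tate: `#Ш(E/K)` is a square). In particular the ℚ-side `2`-adic defect of `W` is EVEN.
[cite: GrossZagier1986, V.(2.2)] [cite: Milne1972ArithmeticAV, §1 Thm. 1] [cite: Cassels1962ArithmeticIV] [cite: JetchevSkinnerWan2017, §7.3.1] -/
theorem frame_core (hF : ToricPublishedInputs) (hMilne : Milne1972.bsdQuotient_baseChange_quadratic)
    (hCT : ∀ (K : Type) [Field K] [NumberField K], WeierstrassCurve.exists_casselsTate_pairing (K := K))
    (W : WeierstrassCurve ℚ) [W.IsElliptic] [W.IsGloballyMinimal] (hr : W.analyticRank = 1)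
    (hTw : ∀ (N : ℕ) [NeZero N] (K : Type) [Field K] [NumberField K]
      (Wd : WeierstrassCurve ℚ) [Wd.IsElliptic] [Wd.IsGloballyMinimal],
      W.conductorNorm ℤ = N → IsImaginaryQuadratic K → SatisfiesHeegnerHypothesis N K →
      (∃ C : VariableChange ℚ, C • W.quadraticTwist (NumberField.discr K : ℚ) = Wd) →
      (W.quadraticTwist (NumberField.discr K : ℚ)).entireLFunction 1 ≠ 0 → BSDp Wd 2)
    {N : ℕ} [NeZero N] (K : Type) [Field K] [NumberField K] (Dt : ModularParametrizationData W N)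
    (H : HeegnerDatum N (NumberField.discr K)) (ι : K →+* ℂ) (P : (W.baseChange K).toAffine.Point)
    (hN : W.conductorNorm ℤ = N) (hK : IsImaginaryQuadratic K) (hHN : SatisfiesHeegnerHypothesis N K)
    (hd4 : NumberField.discr K < -4) (hP : WeierstrassCurve.Affine.Point.map ι.toRatAlgHom P = heegnerPointComplex Dt H)
    (hnt : ¬ IsOfFinAddOrder P) :
    ∃ q : ℚ, shaAn W = (q : ℂ) ∧ ∃ s t : ℕ,
      (padicValNat 2 (Nat.card (AddCommGroup.primaryComponent (W.baseChange K).sha 2)) : ℤ) = 2 * s ∧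
      (padicValNat 2 (W.baseChange K).tamagawaProduct : ℤ) = 2 * t ∧
      padicValRat 2 q - (padicValNat 2 W.shaOrder : ℤ) =
        2 * (padicValNat 2 (AddSubgroup.zmultiples P).index : ℤ) - 2 * (padicValNat 2 Dt.c.natAbs : ℤ) - 2 * t - 2 * s := by
  obtain ⟨hGZ, hKo, hGZK, hmod, -, -, -, -, -, -⟩ := hF
  subst hN
  have h2 : Module.finrank ℚ K = 2 := hK.1
  have hL0 : W.entireLFunction 1 = 0 := entireLFunction_one_eq_zero_of_analyticRank_eq_one hr
  have hLK : LDerivEK W K ≠ 0 :=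
    (lDerivEK_ne_zero_iff_not_isOfFinAddOrder W (W.conductorNorm ℤ) K (hGZ _ W K) hK hHN ⟨Dt, H, ι, hP⟩).mpr hnt
  have hLt : (W.quadraticTwist (NumberField.discr K : ℚ)).entireLFunction 1 ≠ 0 := by
    intro h0
    apply hLK
    rw [lDerivEK_eq_deriv_mul W K hmod hL0, h0, mul_zero]
  have hD0 : (NumberField.discr K : ℚ) ≠ 0 := by exact_mod_cast NumberField.discr_ne_zero K
  haveI hEt : (W.quadraticTwist (NumberField.discr K : ℚ)).IsElliptic := W.isElliptic_quadraticTwist hD0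
  have hrd0 : (W.quadraticTwist (NumberField.discr K : ℚ)).analyticRank = 0 :=
    ((W.quadraticTwist (NumberField.discr K : ℚ)).analyticRank_eq_zero_iff_holds (hmod _)).mpr hLt
  have hrK : (W.baseChange K).analyticRank = 1 :=
    (Summit.BirchSwinnertonDyer.Rank1Residual.P2.analyticRank_baseChange_eq_one_iff W K hmod h2).mpr (Or.inl ⟨hr, hrd0⟩)
  obtain ⟨hShaK, q', hq', hv⟩ :=
    exists_shaAnOver_baseChange_eq_padicValRat_two W K Dt H ι P (hGZ _ W K) (hKo _ W K) hmod hK hd4 hHN hP hrK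
  haveI : Finite (W.baseChange K).sha := hShaK
  haveI : (W.baseChange K).IsGloballyMinimal := W.isGloballyMinimal_baseChange_of_satisfiesHeegnerHypothesis K h2 hHN
  haveI : (W.baseChange K).IsElliptic := isElliptic_baseChange' W K
  obtain ⟨Cd, hCd⟩ := hasGlobalMinimalModel_rat_holds (W.quadraticTwist (NumberField.discr K : ℚ))
  haveI : (Cd • W.quadraticTwist (NumberField.discr K : ℚ)).IsGloballyMinimal := hCd
  have hWd : BSDp (Cd • W.quadraticTwist (NumberField.discr K : ℚ)) 2 :=
    hTw (W.conductorNorm ℤ) K (Cd • W.quadraticTwist (NumberField.discr K : ℚ)) rfl hK hHN ⟨Cd, rfl⟩ hLt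
  have hrW : W.analyticRank ≤ 1 := by rw [hr]
  have hrd : (Cd • W.quadraticTwist (NumberField.discr K : ℚ)).analyticRank ≤ 1 := by
    rw [analyticRank_smul, hrd0]; exact zero_le_one
  obtain ⟨q, hq, hdef⟩ := exists_shaAn_valuation_sub_eq_of_bsdp_twist W 2 K (Cd • W.quadraticTwist (NumberField.discr K : ℚ))
    (W.baseChange K) hGZK hmod hMilne hrW h2 ⟨Cd, rfl⟩ hrd ⟨1, one_smul _ _⟩ hq' hWd
  have hsha : padicValNat 2 (Nat.card (AddCommGroup.primaryComponent (W.baseChange K).sha 2)) =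
      padicValNat 2 (W.baseChange K).shaOrder :=
    Literature.NumberTheory.EllipticCurves.padicValNat_card_addPrimaryComponent 2
  -- parity input 1: `ord₂ c_K = 2 · ord₂ ∏ c_ℓ` at a Heegner field (JSW (7.3.1), X11b exact at every prime)
  have htam : padicValNat 2 (W.baseChange K).tamagawaProduct = 2 * padicValNat 2 W.tamagawaProduct :=
    X11b.padicValNat_tamagawaProduct_baseChange_of_heegner_prime (p := 2) W K hK rfl hHN
  -- parity input 2: Cassels–Tate over `K` ⟹ `#Ш(E/K)` is a perfect square
  obtain ⟨r, hr2⟩ := isSquare_shaOrder_of_casselsTate (hCT K) (W.baseChange K) hShaK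
  have hpos : 0 < (W.baseChange K).shaOrder := shaOrder_pos (W.baseChange K) hShaK
  have hr0 : r ≠ 0 := by
    rintro rfl
    rw [hr2, mul_zero] at hpos
    exact lt_irrefl 0 hpos
  have hshaK : padicValNat 2 (W.baseChange K).shaOrder = 2 * padicValNat 2 r := by
    rw [hr2, padicValNat.mul hr0 hr0]; ring
  refine ⟨q, hq, padicValNat 2 r, padicValNat 2 W.tamagawaProduct, ?_, ?_, ?_⟩
  · rw [hsha]; exact_mod_cast hshaK
  · exact_mod_cast htam
  · rw [hv] at hdef
    have h1 : (padicValNat 2 (W.baseChange K).tamagawaProduct : ℤ) = 2 * (padicValNat 2 W.tamagawaProduct : ℤ) := by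
      exact_mod_cast htam
    have h2' : (padicValNat 2 (W.baseChange K).shaOrder : ℤ) = 2 * (padicValNat 2 r : ℤ) := by exact_mod_cast hshaK
    linarith

/-- **The ℚ-side `2`-adic defect is EVEN** on any curve admitting a Heegner frame as above (GIVEN `hF`, `hMilne`, `hTw`, `hCT`). -/
theorem even_defect_of_frame (hF : ToricPublishedInputs) (hMilne : Milne1972.bsdQuotient_baseChange_quadratic)
    (hCT : ∀ (K : Type) [Field K] [NumberField K], WeierstrassCurve.exists_casselsTate_pairing (K := K))
    (W : WeierstrassCurve ℚ) [W.IsElliptic] [W.IsGloballyMinimal] (hr : W.analyticRank = 1)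
    (hTw : ∀ (N : ℕ) [NeZero N] (K : Type) [Field K] [NumberField K]
      (Wd : WeierstrassCurve ℚ) [Wd.IsElliptic] [Wd.IsGloballyMinimal],
      W.conductorNorm ℤ = N → IsImaginaryQuadratic K → SatisfiesHeegnerHypothesis N K →
      (∃ C : VariableChange ℚ, C • W.quadraticTwist (NumberField.discr K : ℚ) = Wd) →
      (W.quadraticTwist (NumberField.discr K : ℚ)).entireLFunction 1 ≠ 0 → BSDp Wd 2)
    {N : ℕ} [NeZero N] (K : Type) [Field K] [NumberField K] (Dt : ModularParametrizationData W N)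
    (H : HeegnerDatum N (NumberField.discr K)) (ι : K →+* ℂ) (P : (W.baseChange K).toAffine.Point)
    (hN : W.conductorNorm ℤ = N) (hK : IsImaginaryQuadratic K) (hHN : SatisfiesHeegnerHypothesis N K)
    (hd4 : NumberField.discr K < -4) (hP : WeierstrassCurve.Affine.Point.map ι.toRatAlgHom P = heegnerPointComplex Dt H)
    (hnt : ¬ IsOfFinAddOrder P) :
    ∃ q : ℚ, shaAn W = (q : ℂ) ∧ Even (padicValRat 2 q - (padicValNat 2 W.shaOrder : ℤ)) := by
  obtain ⟨q, hq, s, t, -, -, hdef⟩ := frame_core hF hMilne hCT W hr hTw K Dt H ι P hN hK hHN hd4 hP hnt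
  exact ⟨q, hq, (padicValNat 2 (AddSubgroup.zmultiples P).index : ℤ) - padicValNat 2 Dt.c.natAbs - t - s, by rw [hdef]; ring⟩

/-- **DEFECT ONE ⟹ DEFECT ZERO on the `ℚ`-side** (one frame suffices): `ord₂ #Ш_an(W) ≤ ord₂ #Ш(W) + 1 ⟹ MissingLowerBoundAt W 2`,
GIVEN `hF`, `hMilne`, `hTw`, `hCT` and one Heegner frame with `d_K < −4`. The weakest sufficient ℚ-side input of the line. -/
theorem missingLowerBoundAt_of_defectOne_of_frame (hF : ToricPublishedInputs)
    (hMilne : Milne1972.bsdQuotient_baseChange_quadratic)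
    (hCT : ∀ (K : Type) [Field K] [NumberField K], WeierstrassCurve.exists_casselsTate_pairing (K := K))
    (W : WeierstrassCurve ℚ) [W.IsElliptic] [W.IsGloballyMinimal] (hr : W.analyticRank = 1)
    (hQ : ∃ q : ℚ, shaAn W = (q : ℂ) ∧ padicValRat 2 q ≤ (padicValNat 2 W.shaOrder : ℤ) + 1)
    (hTw : ∀ (N : ℕ) [NeZero N] (K : Type) [Field K] [NumberField K]
      (Wd : WeierstrassCurve ℚ) [Wd.IsElliptic] [Wd.IsGloballyMinimal],
      W.conductorNorm ℤ = N → IsImaginaryQuadratic K → SatisfiesHeegnerHypothesis N K →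
      (∃ C : VariableChange ℚ, C • W.quadraticTwist (NumberField.discr K : ℚ) = Wd) →
      (W.quadraticTwist (NumberField.discr K : ℚ)).entireLFunction 1 ≠ 0 → BSDp Wd 2)
    {N : ℕ} [NeZero N] (K : Type) [Field K] [NumberField K] (Dt : ModularParametrizationData W N)
    (H : HeegnerDatum N (NumberField.discr K)) (ι : K →+* ℂ) (P : (W.baseChange K).toAffine.Point)
    (hN : W.conductorNorm ℤ = N) (hK : IsImaginaryQuadratic K) (hHN : SatisfiesHeegnerHypothesis N K)
    (hd4 : NumberField.discr K < -4) (hP : WeierstrassCurve.Affine.Point.map ι.toRatAlgHom P = heegnerPointComplex Dt H)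
    (hnt : ¬ IsOfFinAddOrder P) : MissingLowerBoundAt W 2 := by
  obtain ⟨q, hq, s, t, -, -, hdef⟩ := frame_core hF hMilne hCT W hr hTw K Dt H ι P hN hK hHN hd4 hP hnt
  obtain ⟨q₀, hq₀, hv₀⟩ := hQ
  have hqq : q = q₀ := by exact_mod_cast hq.symm.trans hq₀
  subst hqq
  refine ⟨q, hq, ?_⟩
  omega

/-- **`stub_heegnerIndexLowerAtTwo`'s index LOWER bound from DEFECT ONE** (the one-sided T0 with the parity unit): for ONE curve `W` with
`r_an = 1` and `ord₂ #Ш_an(W) ≤ ord₂ #Ш(W)[2^∞] + 1`, GIVEN `hF`, `hMilne`, `hTw` and Cassels–Tate over number fields (`hCT`, = R1 of the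
STUB-PLAN): `2·ord₂[E(K):ℤP] − 2·ord₂ c ≤ ord₂ #Ш(E/K)[2^∞] + ord₂ c_K` on every Heegner frame with `d_K < −4`. -/
theorem heegnerIndexLower_two_of_defectOne_of_twist (hF : ToricPublishedInputs)
    (hMilne : Milne1972.bsdQuotient_baseChange_quadratic)
    (hCT : ∀ (K : Type) [Field K] [NumberField K], WeierstrassCurve.exists_casselsTate_pairing (K := K))
    (W : WeierstrassCurve ℚ) [W.IsElliptic] [W.IsGloballyMinimal] (hr : W.analyticRank = 1)
    (hQ : ∃ q : ℚ, shaAn W = (q : ℂ) ∧ padicValRat 2 q ≤ (padicValNat 2 W.shaOrder : ℤ) + 1)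
    (hTw : ∀ (N : ℕ) [NeZero N] (K : Type) [Field K] [NumberField K]
      (Wd : WeierstrassCurve ℚ) [Wd.IsElliptic] [Wd.IsGloballyMinimal],
      W.conductorNorm ℤ = N → IsImaginaryQuadratic K → SatisfiesHeegnerHypothesis N K →
      (∃ C : VariableChange ℚ, C • W.quadraticTwist (NumberField.discr K : ℚ) = Wd) →
      (W.quadraticTwist (NumberField.discr K : ℚ)).entireLFunction 1 ≠ 0 → BSDp Wd 2) :
    ∀ (N : ℕ) [NeZero N] (K : Type) [Field K] [NumberField K] (Dt : ModularParametrizationData W N)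
      (H : HeegnerDatum N (NumberField.discr K)) (ι : K →+* ℂ) (P : (W.baseChange K).toAffine.Point),
      W.conductorNorm ℤ = N → IsImaginaryQuadratic K → SatisfiesHeegnerHypothesis N K → NumberField.discr K < -4 →
      WeierstrassCurve.Affine.Point.map ι.toRatAlgHom P = heegnerPointComplex Dt H → ¬ IsOfFinAddOrder P →
      2 * (padicValNat 2 (AddSubgroup.zmultiples P).index : ℤ) - 2 * (padicValNat 2 Dt.c.natAbs : ℤ) ≤
        (padicValNat 2 (Nat.card (AddCommGroup.primaryComponent (W.baseChange K).sha 2)) : ℤ) +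
          (padicValNat 2 (W.baseChange K).tamagawaProduct : ℤ) := by
  intro N _ K _ _ Dt H ι P hN hK hHN hd4 hP hnt
  obtain ⟨q, hq, s, t, hs, ht, hdef⟩ := frame_core hF hMilne hCT W hr hTw K Dt H ι P hN hK hHN hd4 hP hnt
  obtain ⟨q₀, hq₀, hv₀⟩ := hQ
  have hqq : q = q₀ := by exact_mod_cast hq.symm.trans hq₀
  subst hqq
  omega

/-- **T0′ (ℚ-side, defect one).** GIVEN the line's prints `hPr`, 𝔅_split `hB` (GZK, modularity, the CM rank-`0` twin via Burungale–Flach)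
and Cassels–Tate over number fields `hCT` (R1): the DEFECT-ONE ℚ-side halves of the class give the displayed text of the registered stub
`stub_heegnerIndexLowerAtTwo` (the four «given» binders `L(E^{(d_K)},1) ≠ 0`, `r_an(E_K) = 1`, `rank E(K) = 1`, `Ш(E/K)` finite are accepted
and not needed). [cite: Milne1972ArithmeticAV, §1 Thm. 1] [cite: BurungaleFlach2024, Thm. 1.1] [cite: Cassels1962ArithmeticIV] -/
theorem stubLowerText_of_forall_defectOne
    (hPr : ToricPublishedInputs ∧ Milne1972.bsdQuotient_baseChange_quadratic_anyModel)
    (hB : Literature.NumberTheory.EllipticCurves.rank_eq_analyticRank_of_analyticRank_le_one ∧ WeierstrassCurve.hasEntireLFunction_rat ∧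
        WeierstrassCurve.bsdRHS_eq_of_isIsogenous ∧ Literature.NumberTheory.EllipticCurves.bsdTriple_of_hasCM_of_L_one_ne_zero ∧
        Literature.NumberTheory.EllipticCurves.KrizLi2019.thm112_bsdTwo_twist)
    (hCT : ∀ (K : Type) [Field K] [NumberField K], WeierstrassCurve.exists_casselsTate_pairing (K := K))
    (hQ : ∀ (W : WeierstrassCurve ℚ) [W.IsElliptic] [W.IsGloballyMinimal], W.HasCM → W.analyticRank = 1 → CMSplit W 2 → ¬ Good W 2 →
      ∃ q : ℚ, shaAn W = (q : ℂ) ∧ padicValRat 2 q ≤ (padicValNat 2 W.shaOrder : ℤ) + 1) :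
    ∀ (W : WeierstrassCurve ℚ) [W.IsElliptic] [W.IsGloballyMinimal], W.HasCM → W.analyticRank = 1 → CMSplit W 2 → ¬ Good W 2 →
      ∀ (N : ℕ) [NeZero N] (K : Type) [Field K] [NumberField K] (Dt : ModularParametrizationData W N)
        (H : HeegnerDatum N (NumberField.discr K)) (ι : K →+* ℂ) (P : (W.baseChange K).toAffine.Point),
        W.conductorNorm ℤ = N → IsImaginaryQuadratic K → SatisfiesHeegnerHypothesis N K → NumberField.discr K < -4 →
        (W.quadraticTwist (NumberField.discr K : ℚ)).entireLFunction 1 ≠ 0 → (W.baseChange K).analyticRank = 1 →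
        WeierstrassCurve.Affine.Point.map ι.toRatAlgHom P = heegnerPointComplex Dt H → ¬ IsOfFinAddOrder P →
        (W.baseChange K).mordellWeilRank = 1 → Finite (W.baseChange K).sha →
        2 * (padicValNat 2 (AddSubgroup.zmultiples P).index : ℤ) - 2 * (padicValNat 2 Dt.c.natAbs : ℤ) ≤
          (padicValNat 2 (Nat.card (AddCommGroup.primaryComponent (W.baseChange K).sha 2)) : ℤ) +
            (padicValNat 2 (W.baseChange K).tamagawaProduct : ℤ) := by
  intro W _ _ hCM hr hs hg N _ K _ _ Dt H ι P hN hK hHN hd4 _ _ hP hnt _ _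
  have hmod : hasEntireLFunction_rat := hB.2.1
  have hTw : ∀ (N : ℕ) [NeZero N] (K : Type) [Field K] [NumberField K]
      (Wd : WeierstrassCurve ℚ) [Wd.IsElliptic] [Wd.IsGloballyMinimal],
      W.conductorNorm ℤ = N → IsImaginaryQuadratic K → SatisfiesHeegnerHypothesis N K →
      (∃ C : VariableChange ℚ, C • W.quadraticTwist (NumberField.discr K : ℚ) = Wd) →
      (W.quadraticTwist (NumberField.discr K : ℚ)).entireLFunction 1 ≠ 0 → BSDp Wd 2 := by
    intro N _ K _ _ Wd _ _ _ _ _ hC hLt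
    obtain ⟨C, rfl⟩ := hC
    have hd : (NumberField.discr K : ℚ) ≠ 0 := by exact_mod_cast NumberField.discr_ne_zero K
    haveI hEd : (W.quadraticTwist (NumberField.discr K : ℚ)).IsElliptic := W.isElliptic_quadraticTwist hd
    have hCMd : (W.quadraticTwist (NumberField.discr K : ℚ)).HasCM := hasCM_quadraticTwist_of_hasCM W hCM hd
    have hCM' : (C • W.quadraticTwist (NumberField.discr K : ℚ)).HasCM :=
      hasCM_variableChange (W.quadraticTwist (NumberField.discr K : ℚ)) C hCMd
    have hr0d : (W.quadraticTwist (NumberField.discr K : ℚ)).analyticRank = 0 :=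
      ((W.quadraticTwist (NumberField.discr K : ℚ)).analyticRank_eq_zero_iff_holds (hmod _)).mpr hLt
    have hr0 : (C • W.quadraticTwist (NumberField.discr K : ℚ)).analyticRank = 0 := by
      rw [WeierstrassCurve.analyticRank_smul]; exact hr0d
    exact bsdp_cm_rankZero hB.2.2.2.1 hmod hCM' hr0
  exact heegnerIndexLower_two_of_defectOne_of_twist hPr.1 (Milne1972.bsdQuotient_baseChange_quadratic_of_anyModel hPr.2) hCT
    W hr (hQ W hCM hr hs hg) hTw N K Dt H ι P hN hK hHN hd4 hP hnt

/-! ### §2 The ℤ-shadow of the v4.9 chain WITH the parity unit, and the per-key anchor calculus of B26 (d′) -/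

/-- **Chain with parity: INT at `−3` suffices** (k3-g19 `lower_of_chain` had `−1 ≤ eA`; `A − B` even — §1 — buys two units of `eA`). -/
theorem lower_of_chain_even (A B eA junk : ℤ) (hchain : 2 * A + eA + 2 * junk ≤ 2 * B) (hjunk : 0 ≤ junk)
    (hINT : -3 ≤ eA) (hpar : ∃ k : ℤ, A - B = 2 * k) : A ≤ B := by
  obtain ⟨k, hk⟩ := hpar
  omega

/-- … and `−3` is SHARP: at `eA = −4` an even-defect loss survives the chain (k3-g19 `int_sharp` moved by the parity unit). -/
theorem int_sharp_even : ∃ A B eA junk : ℤ, 2 * A + eA + 2 * junk ≤ 2 * B ∧ 0 ≤ junk ∧ eA = -4 ∧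
    (∃ k : ℤ, A - B = 2 * k) ∧ ¬ A ≤ B :=
  ⟨2, 0, -4, 0, by norm_num, le_rfl, rfl, ⟨1, by norm_num⟩, by norm_num⟩

/-- **Per-key anchor bit (B26 (d′)).** At a `BSD₂`-exact anchor of a key with full digit `x₀` the law reads `m₀ = 2x₀ + eA(key)`; a
value certificate `μ ≤ m₀` (`μ = 0` integrality, `1` GHOST, `2` (T)) gives `eA(key) ≥ μ − 2x₀`. -/
theorem eA_ge_of_anchor (m₀ x₀ e μ : ℤ) (hlaw : m₀ = 2 * x₀ + e) (hμ : μ ≤ m₀) : μ - 2 * x₀ ≤ e := by omega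

/-- **Decided keys `(1,7)`, `(0,7)` need NO `(G)`-bit**: anchor digit `x₀ = 1` (784 / 3136) + structural integrality `0 ≤ m₀`
(`KatzMeasureValue.norm_le_one_of_hasValueAt₂`) already give `eA ≥ −2 ≥ −3`. -/
theorem decidedKey_int_of_integrality (m₀ x₀ e : ℤ) (hx : x₀ = 1) (hlaw : m₀ = 2 * x₀ + e) (hint : 0 ≤ m₀) : -3 ≤ e := by
  omega

/-- **Open even keys `(0,1)`, `(0,3)`, `(0,5)`: GHOST at an `x₀ = 2` anchor suffices** (`1 ≤ m₀ ⟹ eA ≥ −3`). -/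
theorem openKey_int_of_ghost (m₀ x₀ e : ℤ) (hx : x₀ = 2) (hlaw : m₀ = 2 * x₀ + e) (hghost : 1 ≤ m₀) : -3 ≤ e := by
  omega

/-- … while integrality alone at an `x₀ = 2` anchor does NOT (witness `m₀ = 0`, `eA = −4`, a losing even chain). -/
theorem openKey_integrality_insufficient :
    ∃ m₀ x₀ e A B : ℤ, x₀ = 2 ∧ m₀ = 2 * x₀ + e ∧ 0 ≤ m₀ ∧ 2 * A + e ≤ 2 * B ∧ (∃ k : ℤ, A - B = 2 * k) ∧ ¬ A ≤ B :=
  ⟨0, 2, -4, 2, 0, rfl, by norm_num, le_rfl, by norm_num, ⟨1, by norm_num⟩, by norm_num⟩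

/-- **Without the parity unit NO open key closes on the `(G)`-road**: the parity-free threshold `−1 ≤ eA` at an anchor with `x₀ ≥ 2`
needs `μ ≥ 3`, beyond the strongest producer (T) (`μ = 2`): witness `x₀ = 2`, `m₀ = 2`, `eA = −2`. -/
theorem noParity_T_insufficient : ∃ m₀ x₀ e : ℤ, x₀ = 2 ∧ m₀ = 2 * x₀ + e ∧ 2 ≤ m₀ ∧ ¬ (-1 ≤ e) :=
  ⟨2, 2, -2, rfl, by norm_num, le_rfl, by norm_num⟩

/-- **Key `(1,3)` floor**: every anchor has `x₀ ≥ 4` (§3), so even with parity the anchor value must be certified to depth `m₀ ≥ 5`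
(`val₀ ∈ 4√2·𝒪`) — out of reach of integrality / GHOST / (T); and `(T)` there yields only `eA ≥ −6`. -/
theorem key13_floor (m₀ x₀ e : ℤ) (hx : 4 ≤ x₀) (hlaw : m₀ = 2 * x₀ + e) :
    (-3 ≤ e → 5 ≤ m₀) ∧ (m₀ = 2 → x₀ = 4 → e = -6) := by
  constructor <;> intros <;> omega

/-! ### §3 R179 is VACUOUS: the local digit of every anchor on an open key is `≥ 2` (typed over the D3 binder's currency) -/

/-- **`ord₂ ∏ c_ℓ(W) ≥ 4` for EVERY model `W` of `X₀(49)^{(d)}` once a prime `ℓ ∤ 14` divides `d`** (`d` squarefree, `d ≢ 1 (mod 4)`;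
both columns `7 ∤ d` / `7 ∣ d` of the Tamagawa table: `c_2 · c_7 = 4 · 2` and `c_ℓ ∈ {2, 4}`).
[cite: Silverman1994, IV.9.4 and Table 4.1] [cite: CoatesLiTianZhai2015, §2] -/
theorem four_le_padicValNat_two_tamagawaProduct {d : ℤ} (hsq : Squarefree d) (hd4 : d % 4 ≠ 1)
    (W : WeierstrassCurve ℚ) [W.IsElliptic] (C : VariableChange ℚ) (hC : C • W = cm7.quadraticTwist (d : ℚ))
    {l : ℕ} (hl : l ∈ d.natAbs.primeFactors) (hl2 : l ≠ 2) (hl7 : l ≠ 7) :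
    4 ≤ padicValNat 2 W.tamagawaProduct := by
  by_cases h7 : (7 : ℤ) ∣ d
  · rw [PrintCf2.TamagawaPlaces.tamagawaProduct_eq_of_smul_eq_cm7_quadraticTwist_of_dvd hsq hd4 h7 W C hC]
    have hlS : l ∈ (d.natAbs.primeFactors.erase 2).erase 7 :=
      Finset.mem_erase.mpr ⟨hl7, Finset.mem_erase.mpr ⟨hl2, hl⟩⟩
    have hdvd : 2 ∣ ∏ x ∈ (d.natAbs.primeFactors.erase 2).erase 7, (if jacobiSym x 7 = -1 then 2 else 4 : ℕ) := by
      refine dvd_trans ?_ (Finset.dvd_prod_of_mem _ hlS)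
      split_ifs
      · exact dvd_rfl
      · exact ⟨2, rfl⟩
    obtain ⟨m, hm⟩ := hdvd
    have hne : 8 * ∏ x ∈ (d.natAbs.primeFactors.erase 2).erase 7, (if jacobiSym x 7 = -1 then 2 else 4 : ℕ) ≠ 0 := by
      refine mul_ne_zero (by norm_num) ?_
      rw [Finset.prod_ne_zero_iff]
      intro x _
      split_ifs <;> norm_num
    refine (padicValNat_dvd_iff_le hne).mp ?_
    rw [hm]
    exact ⟨m, by ring⟩
  · rw [GoldfeldGoodTwists.padicValNat_two_tamagawaProduct_of_smul_eq_cm7_quadraticTwist hsq hd4 h7 W C hC]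
    have hlS : l ∈ d.natAbs.primeFactors.erase 2 := Finset.mem_erase.mpr ⟨hl2, hl⟩
    by_cases hj : jacobiSym l 7 = -1
    · have h1 : 1 ≤ ((d.natAbs.primeFactors.erase 2).filter (fun l : ℕ => jacobiSym l 7 = -1)).card :=
        Finset.card_pos.mpr ⟨l, Finset.mem_filter.mpr ⟨hlS, hj⟩⟩
      omega
    · have h1 : 1 ≤ ((d.natAbs.primeFactors.erase 2).filter (fun l : ℕ => ¬ jacobiSym l 7 = -1)).card :=
        Finset.card_pos.mpr ⟨l, Finset.mem_filter.mpr ⟨hlS, hj⟩⟩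
      omega

/-- **Every F1–F4 anchor has LOCAL DIGIT `g = ord₂Tam − 2·ord₂#tors + 2ℓ ≥ 2`, and `≥ 4` on key `(1,3)`** (`d ≡ 3 (mod 8)`): the three
digit laws of the tree (`ord₂ Tam ≥ 4` above, `#E(ℚ)_tors = 2`, `θ ≤ ℓ`) in the currency of the D3 binder / k1-g22 `xDigit_law`. Hence the
full digit `x₀ = A₀ + g₀` of a rank-one anchor is `≥ 2` (`≥ 4`): ORDER-NOW item R179 («an `x ≤ 1` anchor on an open key») cannot be met.
[cite: Kim2022StructureSelmer, Lemma 3.10] [cite: Silverman1994, Table 4.1] -/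
theorem two_le_localDigit {d : ℤ} (hsq : Squarefree d) (hd4 : d % 4 ≠ 1)
    (W : WeierstrassCurve ℚ) [W.IsElliptic] [W.IsGloballyMinimal] (C : VariableChange ℚ)
    (hC : C • W = cm7.quadraticTwist (d : ℚ)) {l : ℕ} (hl : l ∈ d.natAbs.primeFactors) (hl2 : l ≠ 2) (hl7 : l ≠ 7)
    (P : W.toAffine.Point) (c₀ : ℕ) (ℓ : ℤ) (hc₀ : c₀ ≠ 0)
    (hker : (W.baseChange ℚ_[2]).IsInReductionKernel (c₀ • W.toPadicPoint 2 P))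
    (hnorm : ‖(W.baseChange ℚ_[2]).padicLogPoint (c₀ • W.toPadicPoint 2 P) / (c₀ : ℚ_[2])‖ = (2 : ℝ) ^ (-ℓ)) :
    2 ≤ (padicValNat 2 W.tamagawaProduct : ℤ) - 2 * (padicValNat 2 W.torsionOrder : ℤ) + 2 * ℓ ∧
      (d % 8 = 3 → 4 ≤ (padicValNat 2 W.tamagawaProduct : ℤ) - 2 * (padicValNat 2 W.torsionOrder : ℤ) + 2 * ℓ) := by
  have htam : 4 ≤ padicValNat 2 W.tamagawaProduct := four_le_padicValNat_two_tamagawaProduct hsq hd4 W C hC hl hl2 hl7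
  have htors : W.torsionOrder = 2 := PrintCf2.TamagawaPlaces.torsionOrder_eq_two_of_smul_eq_cm7_quadraticTwist' hsq hd4 W C hC
  have hℓ := PrintCf2.DyadicTorsion.le_ell_of_smul_eq_quadraticTwist d hsq.ne_zero hsq hd4 W C hC P c₀ ℓ hc₀ hker hnorm
  have h1 : padicValNat 2 W.torsionOrder = 1 := by rw [htors, padicValNat_self]
  have htam' : (4 : ℤ) ≤ (padicValNat 2 W.tamagawaProduct : ℤ) := by exact_mod_cast htam
  rw [h1]
  constructor
  · have h0 : (0 : ℤ) ≤ ℓ := le_trans (by split_ifs <;> norm_num) hℓ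
    have h1' : ((1 : ℕ) : ℤ) = 1 := by norm_num
    omega
  · intro h3
    rw [if_pos h3] at hℓ
    omega

/-! ### §4 Norm ↔ exponent glue: value certificates `‖val₀‖ ≤ 2^{−μ/2}` ↦ `μ ≤ m₀`; the law-free B28♯ sandwich -/

/-- A value certificate `‖val‖ ≤ 2^{−μ/2}` against the law `‖val‖ = 2^{−m/2}` reads `μ ≤ m`. -/
theorem mu_le_m_of_norm_le (r : ℝ) (m μ : ℤ) (hr : r = (2 : ℝ) ^ (-(m : ℝ) / 2)) (hle : r ≤ (2 : ℝ) ^ (-(μ : ℝ) / 2)) : μ ≤ m := by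
  rw [hr] at hle
  have h := (Real.rpow_le_rpow_left_iff (by norm_num : (1 : ℝ) < 2)).mp hle
  have : (μ : ℝ) ≤ m := by linarith
  exact_mod_cast this

/-- **Integrality is `μ = 0`**: `‖val‖ ≤ 1` (structural: `KatzMeasureValue.norm_le_one_of_hasValueAt₂` with
`norm_avatarValueAt_sub_one_lt_one_of_units`) against the law gives `0 ≤ m`, i.e. `eA ≥ −2x` at the member. -/
theorem eA_ge_of_integral (r : ℝ) (x e : ℤ) (hr : r = (2 : ℝ) ^ (-((2 * x + e : ℤ) : ℝ) / 2)) (hle : r ≤ 1) : -(2 * x) ≤ e := by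
  have h := mu_le_m_of_norm_le r (2 * x + e) 0 hr (by simpa using hle)
  omega

/-- **GHOST is `μ = 1`**: a NON-UNIT value (`‖val‖ < 1`) against the law gives `1 ≤ m`, i.e. `eA ≥ 1 − 2x`. -/
theorem eA_ge_of_ghost (r : ℝ) (x e : ℤ) (hr : r = (2 : ℝ) ^ (-((2 * x + e : ℤ) : ℝ) / 2)) (hlt : r < 1) : 1 - 2 * x ≤ e := by
  rw [hr] at hlt
  have h := (Real.rpow_lt_rpow_left_iff (by norm_num : (1 : ℝ) < 2)).mp (hlt.trans_eq (Real.rpow_zero 2).symm)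
  have : (0 : ℝ) < ((2 * x + e : ℤ) : ℝ) := by linarith
  have h' : (0 : ℤ) < 2 * x + e := by exact_mod_cast this
  omega

/-- **B28♯ — the law-free weakest sufficient slack WITH parity**: containment `2^{−n′} ≤ ‖val‖` and ANY certified `‖val‖ < 2^{2−x}`
(B28 needed `< 2^{1−x}`) give LOWER `A ≤ B`, since `x − n′ = A − B` is even. -/
theorem lower_of_norm_sandwich_even (A B g x n' : ℤ) (r : ℝ) (hx : x = A + g) (hn : n' = B + g)
    (hcont : (2 : ℝ) ^ (-(n' : ℝ)) ≤ r) (hval : r < (2 : ℝ) ^ ((2 : ℝ) - x)) (hpar : ∃ k : ℤ, A - B = 2 * k) : A ≤ B := by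
  have h := (Real.rpow_lt_rpow_left_iff (by norm_num : (1 : ℝ) < 2)).mp (lt_of_le_of_lt hcont hval)
  have h' : (x : ℝ) < n' + 2 := by linarith
  have h'' : x < n' + 2 := by exact_mod_cast h'
  obtain ⟨k, hk⟩ := hpar
  omega

/-! ### §5 Decidable digits for the «three towers» remark (PLAN 3) -/

/-- `−15 ≡ 7² (mod 64)`, `−15 ≡ 39² (mod 128)`: the digits of `√−15 ∈ ℤ₂` (so `ℚ₂(√u)` and `ℚ₂(√5u)` span the SAME field with the
unramified quadratic `ℚ₂(√5) = ℚ₂(√−3)`: the six keys give THREE towers `ℚ₂^{nr,2^∞}(√d)`, paired by `u ↦ 5u`). -/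
theorem neg_fifteen_square_digits : (7 : ZMod 64) ^ 2 = -15 ∧ (39 : ZMod 128) ^ 2 = -15 := by decide

/-- The `2`-adic unit root `β` of `t² − t + 2` (the ordinary Frobenius eigenvalue of `X₀(49)` at the prime above `2`) has
`β ≡ 27 (mod 64)`; the other root `38` is the non-unit `β̄ = 2/β`. -/
theorem beta_digit : ∀ t : ZMod 64, t * t - t + 2 = 0 → (t = 27 ∨ t = 38) := by decide

/-- … hence `ord₂(1 + β) = 2 ≠ 1 = ord₂(1 − β)`: one explicit descent factor `(1 ∓ β^{±1})` shifts `eA` by exactly `±2` between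
the members of a `χ₅`-pair — inside the parity-tolerant transfer budget `|ΔeA| ≤ 3` of PLAN 3, never zero. -/
theorem beta_descent_shift (β : ℤ) (hβ : β % 64 = 27) :
    (4 ∣ 1 + β ∧ ¬ 8 ∣ 1 + β) ∧ (2 ∣ 1 - β ∧ ¬ 4 ∣ 1 - β) := by
  omega

end Summit.BirchSwinnertonDyer.BirchSwinnertonDyer.Cruxes.SplitBadTwoLowerHalfOfFacts.StubIdeasK1G25

end
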